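import Summits.Ventures.PercRepro.ProfilePointedCircuitClassesStarSharpParXC
import Summits.Ventures.PercRepro.ProfilePointedCircuitClassesStarSharpDefectE
import Summits.Ventures.PercRepro.ProfilePointedCircuitClassesStarSharpD0J

/-!
# PercRepro — THE REGIME `b ∥ y`, `y ∈ X`, OF CASE D0, PART D: THE PLANE `cl{e, f, y}` AND THE KEY LEMMA
(p5, gen 55; `proofs/P5-GM1.md` §82 ADD 7)

When `ρ{e, f, y} = 3`, every bad demand without `c1` is a pair of points of the plane `P₀ = cl{e, f, y}`
(`parX_mem_plane_of_not_c1`), and `X` has at most three points on `P₀` (`parX_card_plane_le_three`).  **Key lemma**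
(`parX_not_two_B_of_A`): a bad demand with `c1` (whose OFF C-endpoint `z` is off `P₀`) and two distinct bad demands
without `c1` cannot coexist — the two pairs cover the three points `t, s′, y` of `X` on `P₀`, the other endpoint `t`
of the `c1`-demand is among them and lies on the line `ey`, so the pairs are `{t, s′}` and `{s′, y}`; but `{s′, y}` is
neither B2 (`ρ{s′, y, f} = 3` from the basis `(X − {z, t}) + f`) nor B1 (`e ∈ cl{t, z, w}` would put `y` there,
against `hfc` at `s′`).
-/

open scoped Matroid

namespace PercRepro.Cogirth

open Finset ThmH Skew Shadow Profile

open Classical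

variable {α : Type} [DecidableEq α] {N : Matroid α} [N.Finite]

section StarSharpParXD

variable {b b' : α}

/-- A bad demand without `c1` lies on the plane `cl{e, f, y}`: each of its points `s` has `ρ{e, f, y, s} = 3`. -/
theorem parX_mem_plane_of_not_c1 (hn : (gr N).card = 9) (h : SeriesPair N b b') {e f : α} (he : e ∈ gr N)
    (hf : f ∈ gr N) (hef : e ≠ f) (heb : e ≠ b) (heb' : e ≠ b') (hfb : f ≠ b) (hfb' : f ≠ b')
    (he1 : ∀ y ∈ ((((gr N).erase b).erase b').erase f).erase e, rk N {e, y} = 2)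
    {y : α} (hyX : y ∈ ((((gr N).erase b).erase b').erase f).erase e) (hpar : rk N {y, b, b'} = 2)
    (hbb2 : rk N {b, b'} = 2) (hefy : rk N {e, f, y} = 3) {W : Finset α} (hW : W ∈ d0DON N b' e f)
    (hc1 : ¬ d0c1 N b e f W) {s : α} (hs : s ∈ (W.erase b).erase e) : rk N (insert s {e, f, y}) = 3 := by
  have hXE : ((((gr N).erase b).erase b').erase f).erase e ⊆ ((gr N).erase b).erase b' :=
    (erase_subset _ _).trans (erase_subset _ _)
  have hXg : ((((gr N).erase b).erase b').erase f).erase e ⊆ gr N :=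
    hXE.trans ((erase_subset _ _).trans (erase_subset _ _))
  have heE : e ∈ ((gr N).erase b).erase b' := mem_erase.2 ⟨heb', mem_erase.2 ⟨heb, he⟩⟩
  have hy1 : rk N ({y} : Finset α) = 1 := by
    have h1 := rk_insert_le_add_one (N := N) he (X := ({y} : Finset α)) (singleton_subset_iff.2 (hXg hyX))
    have h2 := rk_le_card' (M := N) ({y} : Finset α)
    rw [card_singleton] at h2
    rw [he1 y hyX] at h1
    omega
  have hWd := hW
  simp only [d0DON, mem_filter] at hWd
  obtain ⟨-, hπX, -, -, -, hπe, -, hon⟩ := d0_demand_data h hn hf hef heb hfb hfb' (e := e) W hWd.1 hWd.2.1 hWd.2.2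
  have hyπ : rk N (insert y (insert e ((W.erase b).erase e))) = rk N (insert e ((W.erase b).erase e)) :=
    (on_iff_of_parallel h (hXE hyX) hy1 hpar hbb2 (insert_subset heE (hπX.trans hXE))).1 (by rw [hπe]; exact hon)
  unfold d0c1 at hc1
  have h1 := rk_insert_le_add_one (N := N) hf (X := insert e ((W.erase b).erase e)) (insert_subset he (hπX.trans hXg))
  have h2 : rk N (insert e ((W.erase b).erase e)) ≤ rk N (insert f (insert e ((W.erase b).erase e))) :=
    rk_mono' (subset_insert _ _)
  rw [hπe] at h1 h2
  have h3 : rk N (insert f (insert e ((W.erase b).erase e))) = 3 := by omega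
  have h4 := rk_insert_eq_of_rk_insert_eq_subset' (N := N) (S := insert e ((W.erase b).erase e))
    (S' := insert f (insert e ((W.erase b).erase e))) (w := y) (subset_insert _ _) hyπ
  rw [h3] at h4
  have h5 : rk N (insert s {e, f, y}) ≤ rk N (insert y (insert f (insert e ((W.erase b).erase e)))) :=
    rk_mono' (by
      intro u hu; simp only [mem_insert, mem_singleton] at hu
      rcases hu with rfl | rfl | rfl | rfl
      · exact mem_insert_of_mem (mem_insert_of_mem (mem_insert_of_mem hs))
      · exact mem_insert_of_mem (mem_insert_of_mem (mem_insert_self _ _))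
      · exact mem_insert_of_mem (mem_insert_self _ _)
      · exact mem_insert_self _ _)
  have h6 : rk N {e, f, y} ≤ rk N (insert s {e, f, y}) := rk_mono' (subset_insert _ _)
  rw [h4] at h5
  rw [hefy] at h6
  omega

/-- At most three points of `X` lie on the plane `cl{e, f, y}`. -/
theorem parX_card_plane_le_three (hn : (gr N).card = 9) (h : SeriesPair N b b') {e f : α} (he : e ∈ gr N)
    (hf : f ∈ gr N) (hef : e ≠ f) (heb : e ≠ b) (heb' : e ≠ b') (hfb : f ≠ b) (hfb' : f ≠ b')
    (hfc : ∀ y ∈ ((((gr N).erase b).erase b').erase f).erase e, rk N (((((gr N).erase b).erase b').erase f).erase y) = 4)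
    (hX : rk N (((((gr N).erase b).erase b').erase f).erase e) = 4) {y : α} (hefy : rk N {e, f, y} = 3) :
    ((((((gr N).erase b).erase b').erase f).erase e).filter (fun s => rk N (insert s {e, f, y}) = 3)).card ≤ 3 := by
  have hX5 := card_X_eq_five hn h he hf hef heb heb' hfb hfb'
  by_contra hcon
  push Not at hcon
  have hM : rk N ({e, f, y} ∪
      (((((gr N).erase b).erase b').erase f).erase e).filter (fun s => rk N (insert s {e, f, y}) = 3)) = 3 := by
    rw [rk_union_eq_of_forall_insert_eq (N := N) (Y := {e, f, y}) _ (fun s hs => by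
      rw [(mem_filter.1 hs).2, hefy]), hefy]
  have hXM := card_sdiff_add_card_eq_card (filter_subset (fun s => rk N (insert s {e, f, y}) = 3)
    (((((gr N).erase b).erase b').erase f).erase e))
  rw [hX5] at hXM
  have hc1 : (((((gr N).erase b).erase b').erase f).erase e \
      (((((gr N).erase b).erase b').erase f).erase e).filter (fun s => rk N (insert s {e, f, y}) = 3)).card ≤ 1 := by
    omega
  rcases Nat.le_one_iff_eq_zero_or_eq_one.1 hc1 with h0 | h1
  · -- `X ⊆ cl{e, f, y}`: `ρX ≤ 3`
    rw [card_eq_zero, sdiff_eq_empty_iff_subset] at h0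
    have h2 : rk N (((((gr N).erase b).erase b').erase f).erase e) ≤ 3 := by
      rw [← hM]; exact rk_mono' (h0.trans subset_union_right)
    omega
  · -- `X − u ⊆ cl{e, f, y}` for the one point `u` off the plane: `(X + e) − u` has rank `≤ 3`
    obtain ⟨u, hu⟩ := card_eq_one.1 h1
    have huX : u ∈ ((((gr N).erase b).erase b').erase f).erase e := by
      have : u ∈ ((((gr N).erase b).erase b').erase f).erase e \
          (((((gr N).erase b).erase b').erase f).erase e).filter (fun s => rk N (insert s {e, f, y}) = 3) := by
        rw [hu]; exact mem_singleton_self _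
      exact (mem_sdiff.1 this).1
    have h2 : insert e ((((((gr N).erase b).erase b').erase f).erase e).erase u) ⊆
        {e, f, y} ∪ (((((gr N).erase b).erase b').erase f).erase e).filter (fun s => rk N (insert s {e, f, y}) = 3) := by
      intro v hv
      rw [mem_insert] at hv
      rcases hv with rfl | hv
      · exact mem_union_left _ (mem_insert_self _ _)
      have hvu := (mem_erase.1 hv).1
      have hvX := (mem_erase.1 hv).2
      by_cases hvM : v ∈ (((((gr N).erase b).erase b').erase f).erase e).filter (fun s => rk N (insert s {e, f, y}) = 3)
      · exact mem_union_right _ hvM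
      · exfalso
        have : v ∈ ((((gr N).erase b).erase b').erase f).erase e \
            (((((gr N).erase b).erase b').erase f).erase e).filter (fun s => rk N (insert s {e, f, y}) = 3) :=
          mem_sdiff.2 ⟨hvX, hvM⟩
        rw [hu, mem_singleton] at this
        exact hvu this
    have h3 := rk_mono' (M := N) h2
    rw [insert_e_X_erase_eq he hef heb heb' huX, hfc u huX, hM] at h3
    omega

/-- `insert z {e, f, y} = insert y {e, f, z}`. -/
theorem insert_triple_swap (e f y z : α) : insert z ({e, f, y} : Finset α) = insert y {e, f, z} := by
  ext a; simp only [mem_insert, mem_singleton]; tauto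

/-- `insert e {t, y} = insert y {e, t}`. -/
theorem insert_pair_swap (e t y : α) : insert e ({t, y} : Finset α) = insert y {e, t} := by
  ext a; simp only [mem_insert, mem_singleton]; tauto

end StarSharpParXD

end PercRepro.Cogirth
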